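import Summits.Langlands.Langlands.Theorems.QuadraticWindowHostInducedRepGaloisOverK
import HarnessLib

/-!
# Galois representations over the CM field — stub `stub_galoisOverK` of line `one-transparent-pane`,
# file B: the strong-multiplicity-one bridge and the registered signature
(crux `Summit.Langlands.Langlands.Theses.QuadraticWindow.HostInducedRep`, item stmt-Langlands-10902)

File A (`QuadraticWindowHostInducedRepGaloisOverK`, imported) proves `stub_galoisOverK_ess`: the stub with
conjugate self-duality in Fakhruddin–Pilloni's PAIRING form `IsEssConjSelfDual P 1`, conditional on the
tree named fact `FakhruddinPilloni2021_galoisRep_of_weaklyRegular_odd` (F–P, Thm. 9.10).  The registered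
signature of the stub carries conjugate self-duality ALMOST EVERYWHERE ON SATAKE PARAMETERS
(`AutomorphicRepData.IsConjSelfDualAE P c`, `AsaiSign`) instead.  For a cuspidal `P` the two are
equivalent by strong multiplicity one (Jacquet–Shalika 1981 (II), Thm. 4.4, applied to the cuspidal
representations `P^c` and `P^∨`); the direction pairing ⇒ a.e. is proved in the tree
(`IsEssConjSelfDual.eventually_satakeParam_complexConj_eq`), the direction a.e. ⇒ pairing is not (no
contragredient Borel–Jacquet datum, no invariant pairing `P^c × P → ℂ` in the tree), and is recorded
here as the named fact `JacquetShalika1981_isEssConjSelfDual_of_isConjSelfDualAE` (to be relocated to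
`Literature/NumberTheory/Automorphic/WeaklyRegularGaloisRep.lean`, which imports both `AsaiSign` and
`EssConjSelfDual`).  With it, `stub_galoisOverK_cond` proves the registered signature VERBATIM (rank `0`
by hand: a Satake parameter in rank `0` is empty and every `0 × 0` characteristic polynomial is `1`).

LOG (worker, 2026-08-16).  This split copy imports file A under its TARGET module name and can only be
checked once file A is in the tree; its content is checked (rc 0, errors [], warnings [], sorries 0) as
part of the combined work file `work/stubs/GaloisOverK.lean`.  Dry-run verdict of the combined file:
QUEUED [stage route] — "new definitions in Theorems/ are review-queued (D-0009)".  Recommendation: the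
lead reshapes the registered stub to take `(hFP : FakhruddinPilloni2021_galoisRep_of_weaklyRegular_odd)
(hSMO : JacquetShalika1981_isEssConjSelfDual_of_isConjSelfDualAE)` and lands `stub_galoisOverK_cond` by
name.

References: H. Jacquet, J. A. Shalika, Amer. J. Math. 103 (1981), 777–815, Thm. 4.4
[JacquetShalikaAJM1981II]; I. I. Piatetski-Shapiro, *Multiplicity one theorems*, Corvallis (1979)
[PiatetskiShapiroCorvallis1979]; J. Arthur, L. Clozel, Ann. of Math. Stud. 120, Ch. 3 §1
[ArthurClozelAMS120]; J. W. Cogdell, *Analytic theory of L-functions for GL_n* (2004), §2 Thm. 2.1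
[CogdellAnalyticTheory2004]; D. Bump, *Automorphic forms and representations* (1997), §4.2 [Bump1997];
N. Fakhruddin, V. Pilloni, J. Inst. Math. Jussieu 22 (2023), Thm. 9.10 [FakhruddinPilloni2021].
-/

set_option linter.dupNamespace false -- project-wide option (lakefile weak.linter.dupNamespace); `Summit.Langlands.Langlands` is the mandated namespace

open Literature.NumberTheory.Automorphic Literature.NumberTheory.GaloisRepresentations
open IsDedekindDomain NumberField Filter Polynomial

namespace Summit.Langlands.Langlands.Theorems.HostInducedRep.OneTransparentPane

/-! ### The bridge from the a.e.-Satake form of conjugate self-duality, and the registered signature -/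

-- The bridge fact `JacquetShalika1981_isEssConjSelfDual_of_isConjSelfDualAE` (strong multiplicity one in
-- pairing form) was RELOCATED by the gate and LANDED as p95727 in
-- `Literature/NumberTheory/Automorphic/WeaklyRegularGaloisRep.lean` (imported through …GaloisOverK).

/-- **Stub 5 (`stub_galoisOverK`) of line `one-transparent-pane`, registered signature VERBATIM,
conditional on** Fakhruddin–Pilloni, Thm. 9.10 (`hFP`, tree named fact
`FakhruddinPilloni2021_galoisRep_of_weaklyRegular_odd`) **and** strong multiplicity one for the pair
`(P^c, P^∨)` (`hSMO`, `JacquetShalika1981_isEssConjSelfDual_of_isConjSelfDualAE` above).  For a CM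
field `K`, a cuspidal `P` on `GL_N(𝔸_K)` with a `C`-algebraic weakly regular infinity type, conjugate
self-dual almost everywhere on Satake parameters and ODD (standard Asai sign), and an ALGEBRAIC Hecke
character `ψ` of `K`: for every `ℓ`, `ι` there is a continuous SEMISIMPLE `r : Γ_K → GL_N(ℚ̄_ℓ)` which
at every finite `u ∤ ℓ` where `P` has Satake parameter `β` and `ψ` is unramified is unramified with
arithmetic-Frobenius characteristic polynomial `arithFrobPolyOfSatake ι q_u N (β · ψ(ϖ_u)⁻¹)`.
Proof: for `N = 0` the rank-`0` representation (every `0 × 0` characteristic polynomial is `1`, and a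
Satake parameter in rank `0` is empty, `HasSatakeParamAt.card_eq`); for `0 < N`, `hSMO` turns
`IsConjSelfDualAE` into `IsEssConjSelfDual 1` and `stub_galoisOverK_ess` applies.
[cite: FakhruddinPilloni2021, Thm. 9.10] [cite: JacquetShalikaAJM1981II, Thm. 4.4] [cite: Weil1956, §2] -/
theorem stub_galoisOverK_cond :
    FakhruddinPilloni2021_galoisRep_of_weaklyRegular_odd →
    JacquetShalika1981_isEssConjSelfDual_of_isConjSelfDualAE →
    ∀ (N : ℕ) (K : Type) [Field K] [NumberField K] [IsCMField K]
      (hcpt : isCompact_glFiniteIntegralLevel N K) (P : CuspidalAutomorphicRepData N K hcpt)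
      (T : InfinityType K N) (ψ : HeckeCharacter K),
      P.1.HasInfinityType T → T.IsCAlgebraic → T.IsWeaklyRegular →
      P.1.IsConjSelfDualAE (NumberField.IsCMField.complexConj K) →
      P.1.HasAsaiSign (NumberField.IsCMField.complexConj K) 1 → ψ.IsAlgebraic →
    ∀ (ℓ : ℕ) [Fact ℓ.Prime] (ι : PadicAlgCl ℓ ≃+* ℂ),
      ∃ r : FramedGaloisRep K (PadicAlgCl ℓ) N, r.toGaloisRep.IsSemisimple ∧
        ∀ (u : HeightOneSpectrum (𝓞 K)) (β : Multiset ℂ), ((ℓ : ℕ) : 𝓞 K) ∉ u.asIdeal →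
          P.1.HasSatakeParamAt u β → ψ.IsUnramifiedAt u →
            r.IsUnramifiedAt u ∧
              r.HasFrobCharpolyAt u
                (arithFrobPolyOfSatake ι u.residueCard N (β.map (fun b ↦ b * (ψ.valueAtUniformizer u)⁻¹))) := by
  intro hFP hSMO N K _ _ _ hcpt P T ψ hT hC hW hcsd hodd hψ ℓ _ ι
  rcases Nat.eq_zero_or_pos N with rfl | hN
  · -- rank `0`: a (semisimple) rank-`0` representation; all `0 × 0` characteristic polynomials are `1`
    obtain ⟨r, hss, -, -⟩ := IrreducibleGL3CM.stub_continuousSemisimplification K ℓ 0 1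
    refine ⟨r, hss, fun u β _ hβ _ ↦ ⟨fun 𝔓 _ τ _ ↦ Subsingleton.elim _ _, fun 𝔓 _ σ _ ↦ ?_⟩⟩
    have hβ0 : β = 0 := Multiset.card_eq_zero.mp hβ.card_eq
    subst hβ0
    unfold FramedRep.charpoly arithFrobPolyOfSatake
    rw [Multiset.map_zero, Multiset.map_zero, Multiset.prod_zero, Matrix.charpoly,
      Matrix.det_isEmpty]
  · exact stub_galoisOverK_ess hFP N K hcpt P T ψ hT hC hW (hSMO N K hcpt P hN hcsd) hodd hψ ℓ ι

end Summit.Langlands.Langlands.Theorems.HostInducedRep.OneTransparentPane
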